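import Summits.CriticalPhenomena.PercolationContinuityZ3.Theorems.SahiMasterFamilyBottomCoeff
import Mathlib.Algebra.MvPolynomial.Funext

/-!
# The bottom-coefficient recursion (engine of the rare-corner induction), every order

Unit `prim-master-conj` (crux anchor stmt-CriticalPhenomena-4575), gen 8; paper BOTTOM-COEFFICIENT.md §7.1–7.4.  The bottom coefficient of a
family `U` of `k` events with respect to `S` is the coefficient `[∏_{e∈S} X_e] E_k` (exponent `blockProfile S`) of the polynomial `sahiEPoly`.
This file proves, at the level of polynomials:

* `sahiEPoly_peel` — the Lieb–Sahi recursion at an arbitrary slot `i` as an identity of polynomials in the parameters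
  (`E_k(F) = Σ_{l≠i} E_{k−1}(F_{−i}[l ↦ F_l F_i]) − E_{k−1}(F_{−i})·E(F_i)`; from the value identity `sahiE_peel` by `MvPolynomial.funext`);
* `eq_blockProfile_of_add_eq` — the antidiagonal of a square-free exponent consists of complementary square-free exponents;
* `coeff_blockProfile_mul_eq_zero` — if all PROPER square-free coefficients `[X^A] P`, `A ⊊ S`, vanish and `Q` has no constant term, then
  `[X^S](P·Q) = 0`;
* `constantCoeff_exPoly_ind` — `E(1_U)` has constant term `1_U(∅)` (`= 0` for an event not containing the empty configuration);
* **`coeff_blockProfile_sahiEPoly_peel`** — THE RECURSION: if the deleted family `U_{−i}` has vanishing proper square-free coefficients on `S`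
  (paper: "`U_{−i}` is 0-vanishing on `S`", e.g. when `i` is a uniform peeling slot) and `∅ ∉ U_i`, then
  `[X^S] E_k(U) = Σ_{l ≠ i} [X^S] E_{k−1}(U_{−i}[l ↦ U_l ∩ U_i])`.
With (B')_{k−1} and the redundancy lemma (`SahiMasterFamilyRedundancy` for `k = 3`) this is the inductive step of the programme: on families with
a uniform peeling slot the bottom coefficient is a sum of `k−1` bottom coefficients one order down.  Pure algebra; axioms standard. [this work]
-/

noncomputable section

open scoped Classical

namespace Summit.CriticalPhenomena.PercolationContinuityZ3.Theorems

open Finset Function MvPolynomial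
open Literature.Computability.AlgebraicComplexity (blockProfile blockProfile_apply blockProfile_injective)
open Literature.Combinatorics.Sahi2008
open Literature.Probability.Percolation.BHK2006 (weight)
open Literature.Probability.Percolation.DecisionTree (ind ind_of_mem ind_of_not_mem)

variable {ι : Type} [Fintype ι]

/-! ### The peel recursion as a polynomial identity -/

/-- **The Lieb–Sahi recursion peeled at slot `i`, for the polynomials `sahiEPoly`.** [this work] -/
theorem sahiEPoly_peel (n : ℕ) (F : Fin (n + 2) → Set ι → ℝ) (i : Fin (n + 2)) :
    sahiEPoly (n + 2) F =
      (∑ l : Fin (n + 1), sahiEPoly (n + 1) (update (fun j => F (i.succAbove j)) l (F (i.succAbove l) * F i))) -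
        sahiEPoly (n + 1) (fun j => F (i.succAbove j)) * exPoly (F i) := by
  apply MvPolynomial.funext
  intro x
  rw [eval_sahiEPoly, map_sub, map_sum, map_mul, eval_exPoly, eval_sahiEPoly, sahiE_peel (weight x) n F i]
  simp only [eval_sahiEPoly]

/-! ### Square-free exponents and their antidiagonal -/

omit [Fintype ι] in
/-- A pair in the antidiagonal of a square-free exponent `blockProfile S` is a pair of complementary square-free exponents
`(blockProfile A, blockProfile (S \ A))`, `A ⊆ S`. [folklore] -/
theorem eq_blockProfile_of_add_eq {S : Finset ι} {x : (ι →₀ ℕ) × (ι →₀ ℕ)}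
    (hx : x.1 + x.2 = blockProfile S) :
    ∃ A ⊆ S, x.1 = blockProfile A ∧ x.2 = blockProfile (S \ A) := by
  have h : ∀ e, x.1 e + x.2 e = if e ∈ S then 1 else 0 := fun e => by
    have := congrArg (fun f : ι →₀ ℕ => f e) hx
    simpa only [Finsupp.add_apply, blockProfile_apply] using this
  refine ⟨S.filter fun e => x.1 e = 1, filter_subset _ _, ?_, ?_⟩
  · ext e
    have he := h e
    simp only [blockProfile_apply, Finset.mem_filter]
    by_cases heS : e ∈ S
    · simp only [heS, true_and, if_true] at he ⊢
      by_cases h1 : x.1 e = 1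
      · rw [if_pos h1, h1]
      · rw [if_neg h1]; omega
    · simp only [heS, false_and, if_false] at he ⊢
      omega
  · ext e
    have he := h e
    simp only [blockProfile_apply, Finset.mem_sdiff, Finset.mem_filter]
    by_cases heS : e ∈ S
    · simp only [heS, true_and, if_true] at he ⊢
      by_cases h1 : x.1 e = 1
      · rw [if_neg (not_not.2 h1)]; omega
      · rw [if_pos h1]; omega
    · simp only [heS, false_and, if_false] at he ⊢
      omega

omit [Fintype ι] in
/-- **Square-free coefficient of a product**: if every proper square-free coefficient `[X^A] P` (`A ⊊ S`) vanishes and `Q` has zero constant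
term, then `[X^S](P Q) = 0`. [this work] -/
theorem coeff_blockProfile_mul_eq_zero {S : Finset ι} {P Q : MvPolynomial ι ℝ}
    (hP : ∀ A, A ⊂ S → coeff (blockProfile A) P = 0) (hQ : constantCoeff Q = 0) :
    coeff (blockProfile S) (P * Q) = 0 := by
  rw [coeff_mul]
  refine Finset.sum_eq_zero fun x hx => ?_
  obtain ⟨A, hAS, h1, h2⟩ := eq_blockProfile_of_add_eq (Finset.HasAntidiagonal.mem_antidiagonal.1 hx)
  rw [h1, h2]
  by_cases hA : A = S
  · subst hA
    have h0 : blockProfile (A \ A) = (0 : ι →₀ ℕ) := by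
      rw [sdiff_self]; exact Literature.Computability.AlgebraicComplexity.blockProfile_empty
    rw [h0, ← constantCoeff_eq, hQ, mul_zero]
  · rw [hP A (Finset.ssubset_iff_subset_ne.2 ⟨hAS, hA⟩), zero_mul]

/-! ### Constant terms of expectation polynomials -/

/-- The product weight at parameter `0` is the point mass at the empty configuration. [folklore] -/
theorem weight_zero_apply (ω : Set ι) : weight (0 : ι → ℝ) ω = if ω = ∅ then 1 else 0 := by
  unfold weight
  by_cases hω : ω = ∅
  · rw [if_pos hω]
    exact Finset.prod_eq_one fun e _ => by rw [hω]; simp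
  · rw [if_neg hω]
    obtain ⟨e, he⟩ := Set.nonempty_iff_ne_empty.2 hω
    exact Finset.prod_eq_zero (Finset.mem_univ e) (by rw [if_pos he]; rfl)

/-- `E(h)` has constant term `h(∅)`. [this work] -/
theorem constantCoeff_exPoly (h : Set ι → ℝ) : constantCoeff (exPoly h) = h ∅ := by
  rw [← MvPolynomial.eval_zero, eval_exPoly, ex]
  simp only [weight_zero_apply, ite_mul, one_mul, zero_mul, Finset.sum_ite_eq', Finset.mem_univ, if_true]

/-- `E(1_U)` has zero constant term when `∅ ∉ U`. [this work] -/
theorem constantCoeff_exPoly_ind {U : Set (Set ι)} (hU : ∅ ∉ U) : constantCoeff (exPoly (ind U)) = 0 := by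
  rw [constantCoeff_exPoly, ind_of_not_mem hU]

/-! ### The bottom-coefficient recursion -/

/-- **The bottom-coefficient recursion.**  Let `U` be a family of `n + 2` events, `i` a slot with `∅ ∉ U_i`, and `S` a set of coordinates such
that the deleted family `U_{−i}` has vanishing proper square-free coefficients on `S` (`[X^A] E_{n+1}(U_{−i}) = 0` for `A ⊊ S`; paper: `U_{−i}`
is 0-vanishing on `S` — e.g. `i` a uniform peeling slot).  Then
`[X^S] E_{n+2}(U) = Σ_l [X^S] E_{n+1}(U_{−i}[l ↦ U_l ∩ U_i])`. [this work] -/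
theorem coeff_blockProfile_sahiEPoly_peel {n : ℕ} (U : Fin (n + 2) → Set (Set ι)) (i : Fin (n + 2)) (S : Finset ι)
    (hUi : ∅ ∉ U i)
    (hlow : ∀ A, A ⊂ S → coeff (blockProfile A) (sahiEPoly (n + 1) fun j => ind (U (i.succAbove j))) = 0) :
    coeff (blockProfile S) (sahiEPoly (n + 2) fun j => ind (U j)) =
      ∑ l : Fin (n + 1), coeff (blockProfile S)
        (sahiEPoly (n + 1) fun j => ind (update (fun j => U (i.succAbove j)) l (U (i.succAbove l) ∩ U i) j)) := by
  rw [sahiEPoly_peel n (fun j => ind (U j)) i, coeff_sub, coeff_sum,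
    coeff_blockProfile_mul_eq_zero hlow (constantCoeff_exPoly_ind hUi), sub_zero]
  refine Finset.sum_congr rfl fun l _ => ?_
  rw [ind_update_inter (fun j => U (i.succAbove j)) l (U i)]

/-- **The recursion for the full bottom coefficient** (`S = univ`): if `[X^A] E_{n+1}(U_{−i}) = 0` for every `A ≠ univ` and `∅ ∉ U_i` then
`[∏_e X_e] E_{n+2}(U) = Σ_l [∏_e X_e] E_{n+1}(U_{−i}[l ↦ U_l ∩ U_i])`. [this work] -/
theorem bottomCoeff_peel {n : ℕ} (U : Fin (n + 2) → Set (Set ι)) (i : Fin (n + 2)) (hUi : ∅ ∉ U i)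
    (hlow : ∀ A : Finset ι, A ≠ univ → coeff (blockProfile A) (sahiEPoly (n + 1) fun j => ind (U (i.succAbove j))) = 0) :
    coeff (blockProfile (univ : Finset ι)) (sahiEPoly (n + 2) fun j => ind (U j)) =
      ∑ l : Fin (n + 1), coeff (blockProfile (univ : Finset ι))
        (sahiEPoly (n + 1) fun j => ind (update (fun j => U (i.succAbove j)) l (U (i.succAbove l) ∩ U i) j)) :=
  coeff_blockProfile_sahiEPoly_peel U i univ hUi fun A hA => hlow A (Finset.ssubset_iff_subset_ne.1 hA).2

end Summit.CriticalPhenomena.PercolationContinuityZ3.Theorems
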